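import Summits.CriticalPhenomena.PercolationContinuityZ3.Theses.PercNearOneGluing
import Literature.Probability.Percolation.PercolationEvents
import HarnessLib.Audit

/-!
# Line `kn-shortening-induction` — Kozma–Nitzan's SHORTENING INDUCTION (Conjecture 6 ⟹ Conjecture 1 ⟹ crux)

Alternative skeleton for the crux `PercNearOneGluing.NearOneGluing` (item stmt-CriticalPhenomena-4574 =
Kozma–Nitzan Conjecture 3, arXiv:2401.12397 p.15), registered by the crux strategist
(planner-cstrat-stmt-CriticalPhenomena-4574-s1-0, 2026-08-16) ALONGSIDE the live line `Lines/SketchR2I5.lean`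
(lead c4: MAXATT / GL3).  It does not touch that skeleton or its stubs.

## The line in one paragraph (KN §5.3, p.34: Conjecture 6 + Lemma 13)
Write `μ_w = prodBernoulli w` on bond configurations of the complete graph on `Fin n` (weight `0` = absent pair),
`P_w(x ↔ y) = μ_w(openConn x y)`.  KN CONJECTURE 1: `P(o ↔ b) ≥ P(o ↔ A) · min_{a∈A} P(a ↔ b)` on every finite
weighted graph; it implies the crux with `δ = ε/2` (stub 3).  KN's own inductive route to Conjecture 1
(Lemma 13): induct on the number of positive-weight pairs.  For a pair `e = s(o, x)` AT THE SOURCE put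
`H_p := w[e ↦ p]`; every `μ_{H_p}(S)` is AFFINE in `p` (one-bond decomposition), hence
`f(p) := P_{H_p}(o ↔ b) − P_{H_p}(o ↔ A) · P_{H_p}(a₀ ↔ b)` is CONCAVE (the subtracted product of two
non-decreasing affine functions is convex); `f(0) ≥ 0` is Conjecture 1 for `H_0` (fewer positive pairs:
induction), and `f(1) ≥ 0` — Conjecture 1's inequality for the CONTRACTED graph `H_1 = H_0 / {o, x}`, measured
against the OLD minimiser `a₀` of `H_0` — is exactly KN CONJECTURE 6 (the "shortening step", stub 1, the one
conjectural stub of this line); concavity gives `f(w e) ≥ 0`, i.e. Conjecture 1 for `w` at the source `o`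
(stub 2 = Lemma 13).  Composition: stub 3 ∘ stub 2 ∘ stub 1 proves the crux BY NAME (`NearOneGluing_of`).

## Why this is a different line (and why it might be easier)
The live line attacks a HITTING-RULE covariance inequality (GL3/MAXATT: "no positive self-selection of the
least reliable attached relay").  This line's kernel is a ONE-PAIR CONTRACTION step: compare `μ_{H_0}` with
`μ_{H_0}( · ∣ e open)` for a single pair `e` at the source, with the full induction hypothesis (Conjecture 1 for
every weight function supported inside the support of `H_0`) in hand.  Conditioning on one open pair at the
source is the regime of KN Lemma 5 / Theorem 5 (proved via Lemma 3(i)); the sibling crux AdditiveGluing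
(stmt-4576) runs the same one-bond calculus for the stronger pre-FKG "good quadruple" functional
(`Theorems/PercNearOneGluingAdditiveGluingGoodStepOfGlueStep.lean`: `goodStep_lhs_affine`, GlueStep), whose
kernel implies this one; Conjecture 6 is the WEAKEST kernel of that family (post-FKG), hence the most likely
to be true.  KN Theorem 13 (p.37) kills only the version with an ARBITRARY designated relay (reproduced:
explicit 4-vertex one-sided and 6-vertex two-sided witnesses, strategist lab); the minimiser version has
0 violations in ≈ 6·10³ exact random instances (n ≤ 6) and ≈ 165 adversarial weight climbs (n ≤ 8).

## Stubs (3, registered)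
* `stub_shorteningStep` — KN Conjecture 6 with the induction hypothesis displayed (CONJECTURAL; the kernel).
* `stub_lemma13` — KN Lemma 13: the step implies Conjecture 1 (strong induction on the positive support +
  one-bond affinity + concavity).  Provable, size M.
* `stub_conj1Gluing` — Conjecture 1 implies the crux (`δ = ε/2`).  Provable, size S.

## Disproof used (tree `Cruxes/NearOneGluing/Disproof.lean` v8)
`nearOneGluing_false_without_relay` / `_without_reliability`: both hypotheses are consumed in stub 3 (`P(o ↔ A)`
is the factor, reliability is `t = 1 − δ`).  `unionBound_rate_sharp` (no `δ = cε` with `c > 1/2`): stub 3 uses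
`δ = ε/2`, consistent.  `nearOneGluing_iff_saturated`, §9 pocket decomposition, Targets (`stub_doomWindow`,
`stub_giantPocketsRare`): not used.  BarrierSharedBit: the kernel is an inequality between `μ_w` and
`μ_w( · ∣ e open)` for ONE pair — it spends edge-independence (the one-bond decomposition is false for a shared
bit), so the barrier does not vacate it; the shared-bit model has no single-pair contraction.
-/

namespace Summit.CriticalPhenomena.PercolationContinuityZ3.Cruxes.NearOneGluing.KnShorteningInduction

open MeasureTheory Set Literature.Probability.LatticeModels Literature.Probability.Percolation
open scoped Classical BigOperators

/-! ## Stub 1 — the kernel: KN Conjecture 6 (shortening step against the old minimiser), IH displayed -/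

/-- STUB 1 (CONJECTURAL — Kozma–Nitzan Conjecture 6, arXiv:2401.12397 p.34, with Lemma 13's induction
hypothesis made available).  Setting: weight function `w` on the pairs of `Fin n`, relay set `A`, target `b`,
source `v ∉ A`, a second vertex `x ≠ v` with `w s(v, x) = 0` (the pair to be contracted is absent), and a
minimiser `a₀ ∈ A` of `a ↦ P_w(a ↔ b)` over `A`.  INDUCTION HYPOTHESIS (available in Lemma 13's induction on the
number of positive pairs, since every such `w'` has at most as many positive pairs as `w`): Conjecture 1 holds
for every weight function `w'` whose positive pairs are positive pairs of `w` — in particular for `w` itself,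
which gives KN's displayed hypotheses (39) at `v` and at `x`.  CLAIM (KN (40)): in the contracted graph
`w[s(v,x) ↦ 1]`,  `P(v ↔ A) · P(a₀ ↔ b) ≤ P(v ↔ b)`  — Conjecture 1's inequality at the glued source, measured
against the OLD minimiser `a₀`.  Evidence: strategist lab (exact enumeration): 0 violations in 5 676 random
hypothesis-satisfying cases (n ≤ 6, |A| ≤ 4, all second vertices `x`) and in ≈ 165 adversarial coordinate
climbs on the weights (n ≤ 8, m ≤ 11); the arbitrary-relay version is false (KN Thm 13; explicit witnesses
n = 4 one-sided, n = 6 two-sided).  Why it might fail: contraction can re-order the relays (the new minimiser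
may differ from `a₀`); KN are "hesitant" about every "which relay" statement (Questions 7–9). -/
theorem stub_shorteningStep :
    ∀ (n : ℕ) (w : Sym2 (Fin n) → unitInterval) (A : Finset (Fin n)) (b v x a₀ : Fin n),
      v ∉ A → v ≠ x → w s(v, x) = 0 → a₀ ∈ A →
      (∀ a ∈ A, (prodBernoulli w).real (openConn a₀ b) ≤ (prodBernoulli w).real (openConn a b)) →
      (∀ w' : Sym2 (Fin n) → unitInterval, (∀ e, w e = 0 → w' e = 0) →
        ∀ (A' : Finset (Fin n)) (o' b' : Fin n) (t : ℝ),
          (∀ a ∈ A', t ≤ (prodBernoulli w').real (openConn a b')) →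
          (prodBernoulli w').real (⋃ a ∈ A', openConn o' a) * t ≤ (prodBernoulli w').real (openConn o' b')) →
      (prodBernoulli (Function.update w s(v, x) 1)).real (⋃ a ∈ A, openConn v a) *
          (prodBernoulli (Function.update w s(v, x) 1)).real (openConn a₀ b) ≤
        (prodBernoulli (Function.update w s(v, x) 1)).real (openConn v b) := by
  sorry

/-! ## Stub 2 — KN Lemma 13: the shortening step implies Conjecture 1 -/

/-- STUB 2 (size M; sources: KN Lemma 13 p.34; one-bond decomposition
`μ_w(S) = (1 − w e) μ_{w[e↦0]}(S) + (w e) μ_{w[e↦1]}(S)` as in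
`Theorems/PercNearOneGluingAdditiveGluingGoodStepOneBond.lean` (`stub_oneBondDecomp_k8`) /
`…GoodStepOfGlueStep.lean` (`goodStep_real_decomp`); `prodBernoulli_real_forall_notMem` for the base case).
**The shortening step implies KN Conjecture 1** (min-free typing: every common lower bound `t` of the
`P(a ↔ b)`, `a ∈ A`, gives `P(o ↔ A) · t ≤ P(o ↔ b)`).  Proof route: strong induction on the number of pairs `e`
with `w e ≠ 0`.  Fix `w, A, o, b, t`.  If `o ∈ A`: `P(o ↔ A) · t ≤ t ≤ P(o ↔ b)` (when `t ≥ 0`; for `t < 0` the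
claim is trivial).  If every pair at `o` has weight `0`: `P(o ↔ a) = 0` for `a ≠ o`, so the left side vanishes.
Otherwise pick `x` with `w s(o,x) ≠ 0`, put `H₀ := w[s(o,x) ↦ 0]` (strictly fewer positive pairs),
`H₁ := w[s(o,x) ↦ 1]`, `p := w s(o,x)`, and let `a₀` minimise `a ↦ P_{H₀}(a ↔ b)` on `A` (nonempty, else
trivial).  By induction Conjecture 1 holds for every `w'` supported inside the support of `H₀`; in particular
`X₀ − Y₀ Z₀ ≥ 0` where `X = P(o↔b)`, `Y = P(o↔A)`, `Z = P(a₀↔b)` (subscript = which of `H₀, H₁`), and the step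
(hypothesis, applied to `H₀`) gives `X₁ − Y₁ Z₁ ≥ 0`.  One-bond decomposition: `X_w = (1−p)X₀ + pX₁`, same for
`Y, Z`, with `Y₀ ≤ Y₁`, `Z₀ ≤ Z₁` (increasing events); hence
`X_w − Y_w Z_w ≥ (1−p)(X₀ − Y₀Z₀) + p(X₁ − Y₁Z₁) + p(1−p)(Y₁ − Y₀)(Z₁ − Z₀) ≥ 0`, and finally
`Y_w · t ≤ Y_w · Z_w ≤ X_w` since `t ≤ P_w(a₀ ↔ b) = Z_w`. -/
theorem stub_lemma13 :
    (∀ (n : ℕ) (w : Sym2 (Fin n) → unitInterval) (A : Finset (Fin n)) (b v x a₀ : Fin n),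
      v ∉ A → v ≠ x → w s(v, x) = 0 → a₀ ∈ A →
      (∀ a ∈ A, (prodBernoulli w).real (openConn a₀ b) ≤ (prodBernoulli w).real (openConn a b)) →
      (∀ w' : Sym2 (Fin n) → unitInterval, (∀ e, w e = 0 → w' e = 0) →
        ∀ (A' : Finset (Fin n)) (o' b' : Fin n) (t : ℝ),
          (∀ a ∈ A', t ≤ (prodBernoulli w').real (openConn a b')) →
          (prodBernoulli w').real (⋃ a ∈ A', openConn o' a) * t ≤ (prodBernoulli w').real (openConn o' b')) →
      (prodBernoulli (Function.update w s(v, x) 1)).real (⋃ a ∈ A, openConn v a) *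
          (prodBernoulli (Function.update w s(v, x) 1)).real (openConn a₀ b) ≤
        (prodBernoulli (Function.update w s(v, x) 1)).real (openConn v b)) →
    ∀ (n : ℕ) (w : Sym2 (Fin n) → unitInterval) (A : Finset (Fin n)) (o b : Fin n) (t : ℝ),
      (∀ a ∈ A, t ≤ (prodBernoulli w).real (openConn a b)) →
      (prodBernoulli w).real (⋃ a ∈ A, openConn o a) * t ≤ (prodBernoulli w).real (openConn o b) := by
  sorry

/-! ## Stub 3 — Conjecture 1 implies the crux -/

/-- STUB 3 (size S; sources: KN p.15 "Conjecture 3 clearly follows from Conjecture 1"; cf. the landed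
`stub_maxattGlue` / `stub_lrfGlue` for the `measureReal` bookkeeping).  **KN Conjecture 1 implies
`NearOneGluing`.**  Given `ε > 0` take `δ := ε / 2`; for an instance at level `δ` apply the hypothesis with
`t := 1 − δ` (a common lower bound by the relay hypothesis): `P(o ↔ b) ≥ P(o ↔ A)(1 − δ) > (1 − δ)² ≥ 1 − 2δ
= 1 − ε`. -/
theorem stub_conj1Gluing :
    (∀ (n : ℕ) (w : Sym2 (Fin n) → unitInterval) (A : Finset (Fin n)) (o b : Fin n) (t : ℝ),
      (∀ a ∈ A, t ≤ (prodBernoulli w).real (openConn a b)) →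
      (prodBernoulli w).real (⋃ a ∈ A, openConn o a) * t ≤ (prodBernoulli w).real (openConn o b)) →
    Summit.CriticalPhenomena.PercolationContinuityZ3.Theses.PercNearOneGluing.NearOneGluing := by
  sorry

/-! ## Composition: the crux BY NAME from the three stubs (real proof) -/

/-- **`NearOneGluing` from the shortening induction**: KN Conjecture 6 (with IH) ⟹ Conjecture 1 ⟹ crux. -/
theorem NearOneGluing_of :
    Summit.CriticalPhenomena.PercolationContinuityZ3.Theses.PercNearOneGluing.NearOneGluing :=
  stub_conj1Gluing (stub_lemma13 stub_shorteningStep)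

end Summit.CriticalPhenomena.PercolationContinuityZ3.Cruxes.NearOneGluing.KnShorteningInduction
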